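import Literature.NumberTheory.NumberFields.ClassNumberCrudeBound
import Literature.NumberTheory.EllipticCurves.HeegnerPoints
import HarnessLib

set_option linter.dupNamespace false -- `Summit.BirchSwinnertonDyer.BirchSwinnertonDyer.Theorems.…` (summit = sub)
set_option autoImplicit false

/-!
# Crux `HeegnerTwistCouplingInSupply` (stmt-BirchSwinnertonDyer-21381), line `size-tail`: stub `stub_sizeIndivisible`
# — `p ∤ h(K′)` is free by SIZE below the Minkowski threshold — PROVED

Route `BiquadraticEisensteinDescent` (cell `pub/bsd-wall`, row-12 lead `bsd-wall-cm-bed-p1` g0, D-0152 M1). Skeleton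
of record `size_tail` (tree `Cruxes/HeegnerTwistCouplingInSupply/Lines/size_tail.lean`): the first stub is the SIZE
lever of crux-ideate round 1 (§G7 BULK/TAIL) in kernel strength — an imaginary quadratic field `K′` with
`121·|d_K′| < p` has `p ∤ h(K′)`, since `1 ≤ h(K′) ≤ 11^{n_K′}·|d_K′| = 121·|d_K′| < p` by the tree's Minkowski bound
`Literature.NumberTheory.NumberFields.classNumber_le_pow_mul_natAbs_discr` (Thorner–Zaman 2019 Lemma 2.4, proved in
the tree). THEOREMS ONLY; imports no `Theses` module; nothing about the crux's tail or any case of BSD is asserted.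
Supports stmt-BirchSwinnertonDyer-21381 (proves the registered stub by name and signature).
-/

noncomputable section

open scoped NumberField

open NumberField Literature.NumberTheory.EllipticCurves

namespace Summit.BirchSwinnertonDyer.BirchSwinnertonDyer.Theorems.BiquadraticEisensteinDescentHeegnerTwistCouplingInSupplySizeIndivisible

/-- **Stub `stub_sizeIndivisible` of line `size-tail` (PROVED).** For a prime `p` and an imaginary quadratic field
`K′` with `121·|d_K′| < p`: `p ∤ h(K′)`. Proof: `h(K′) ≤ 11² · |d_K′|` (Minkowski, tree theorem
`classNumber_le_pow_mul_natAbs_discr` with `n_K′ = 2`), `h(K′) ≥ 1`, so `0 < h(K′) < p` and `p ∣ h(K′)` is impossible.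
[cite: ThornerZaman2019, Lemma 2.4 (proof)] -/
theorem stub_sizeIndivisible :
    ∀ (p : ℕ) [Fact p.Prime] (K : Type) [Field K] [NumberField K],
      IsImaginaryQuadratic K → 121 * (NumberField.discr K).natAbs < p → ¬ p ∣ NumberField.classNumber K := by
  intro p _ K _ _ hK hlt hdvd
  have hle := Literature.NumberTheory.NumberFields.classNumber_le_pow_mul_natAbs_discr K
  rw [hK.1] at hle
  have hpos : 0 < NumberField.classNumber K := Fintype.card_pos
  have hple : p ≤ NumberField.classNumber K := Nat.le_of_dvd hpos hdvd
  omega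

end Summit.BirchSwinnertonDyer.BirchSwinnertonDyer.Theorems.BiquadraticEisensteinDescentHeegnerTwistCouplingInSupplySizeIndivisible

end
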